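import Literature.MathematicalPhysics.QuantumFieldTheory.Balaban1983to89.T3MinimiserStabilityReduction
import Literature.MathematicalPhysics.QuantumFieldTheory.Balaban1983to89.T3PrintedRegularMinimiser
import Literature.MathematicalPhysics.QuantumFieldTheory.Balaban1983to89.T3OrbitAverage
import Literature.MathematicalPhysics.QuantumFieldTheory.Balaban1983to89.B12ContinuousTransportInvariance
import Literature.MathematicalPhysics.QuantumFieldTheory.Balaban1983to89.Node00.CanonicalTransportOfRecord
import Summits.QuantumFields.YangMills.Theorems.FluctuationComparisonRegPrIntLWreg
import Literature.Analysis.FluidPDE.DriftMildBootstrap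
import HarnessLib

/-!
# Route `UnitScaleTilt` — crux `FluctuationComparisonRegPrIntL` (stmt-QuantumFields-20520), organ S2β: THE GRADIENT-SPLIT KNIT OF LINES g24-1 ∕ g24-2 AS IMPORTABLE
# THEOREMS — P∘ (positivity of the small-history density on every interior window) PROVED from ✓WREG, the junctions OSC¹∘ → GRAD¹∘, GRAD¹∘ → TAILSUP∘ → GRAD∘,
# GRAD∘ → CRUDELOC → S2β (row TEXTS inline, no schema), and the pure real-analysis «super-polynomial size × polynomial-modulus decay» interpolation

TYPED by ideator `ym-r3-idea-1` g24 in the crux workfiles `Cruxes/FluctuationComparisonRegPrIntL/Lines/gradient_split.lean` (LINE g24-1, 88df3c0a) and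
`Lines/gradient_resolved.lean` v2 (LINE g24-2, 8264344b) — NOT importable, NOT registered (RULING №36 (3)); LIFTED into this def-free Theorems file by width seat
`ym3-torus-px20` g12 on the ideator's 10:35:19Z support-need word: every theorem below is the ideator's, PROOF BLOCKS BYTE-IDENTICAL, with the organ rows that the Lines
files keep as `def … : Prop` (S2β `FluctuationPartSmall` = the registry crux_decl's text, CRUDELOC `CrudeLocalityCan`, GRAD∘ `OneBondOscillationCan`, GRAD₁∘, GRAD¹∘
`SmallHistoryOneBondIntCan`, GRAD¹₁∘, P∘ `SmallHistoryPositiveIntCan`, OSC¹∘ `SmallHistoryOscillationIntCan`, TAILSUP∘ `WindowOddsSupIntCan`) written INLINE as hypothesis ∕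
conclusion TEXTS (their `def` bodies verbatim — door-fit by script; no hypothesis schema is declared here, WORD 96), and the canonical density `heightDensityCan` taken from
✓`FluctuationComparisonRegPrIntLWregGlue` (same definition as the Lines files' local copy).

WHAT THIS FILE PROVES (nothing of Bałaban's analysis; junctions, one positivity fact from ✓WREG, and real analysis):
* from g24-1: `oneBondOscillationDepthOne_of` (GRAD∘ → GRAD₁∘), `abs_fourDiff_le_of_oneBond` (the window 4-point is two one-bond differences: `|Δ²f| ≤ 2σ`),
  `sqrt_exp_neg` (the interpolation inequality `min x y ≤ √(xy)` is lit ✓`Literature.Analysis.FluidPDE.min_le_sqrt_mul`, imported — gate dedup), ★`fluctuationPartSmall_of_gradient_split : ⟨GRAD∘⟩ → ⟨CRUDELOC⟩ → ⟨S2β⟩` (the interpolation knit `min(2σ_J, C_J e^{−κ₀d}) ≤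
  √(2σ_JC_J)·e^{−κ₀d∕2}`, `J·√(2σ_JC_J) → 0` — super-polynomial size × polynomial modulus), `crudeLocality_of_fluctuationPartSmall : ⟨S2β⟩ → ⟨CRUDELOC⟩`;
* from g24-2 v2: `smallHistoryOneBondDepthOne_of`, `θBal_const_mul'`, `θBal_nonneg'`, `plaqSmall_of_interior`, ★`smallHistoryPositiveInt : ⟨P∘⟩` (PROVED from
  ✓`FluctuationComparisonRegPrIntLWreg.windowRegularity`), `smallHistoryOneBond_of_pos_osc`, ★`smallHistoryOneBond_of_osc : ⟨OSC¹∘⟩ → ⟨GRAD¹∘⟩`, `abs_sub_le_of_mem_Icc`,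
  ★`oneBondOscillation_of_resolved : ⟨GRAD¹∘⟩ → ⟨TAILSUP∘⟩ → ⟨GRAD∘⟩`.
NET (the ideator's census, unchanged): S2β ⟸ {OSC¹∘, TAILSUP∘, CRUDELOC}; this file makes the three arrows importable BY NAME.
HONEST: nothing of OSC¹∘ ∕ TAILSUP∘ ∕ GRAD∘ ∕ CRUDELOC ∕ S2β ∕ crux 20520 ∕ `YM3TorusSU2` is proved here (P∘ and the junctions are); rung R3 = SU(2) YM₃ on T³ — NOT d = 4,
NOT infinite volume, NOT a mass gap, NOT Clay.

References: [Balaban1985UV3] CMP 102 (1985) 255–275 ((41) p.266, (45)–(47) p.267); [Balaban1987RG1] CMP 109 (1987) 249–301 (Thm 1 (0.19)–(0.26));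
[Balaban1985Variational] CMP 102 (1985) 277–309 (Thm 1 (8)–(10) p.279); [Balaban1985Averaging] CMP 98 (1985) 17–51 ((10) p.19).
-/

noncomputable section

set_option autoImplicit false

open MeasureTheory Filter Topology Set
open Literature.MathematicalPhysics.QuantumFieldTheory.Balaban1983to89
open Literature.MathematicalPhysics.QuantumFieldTheory.Balaban1983to89.T3ContinuumYM3Torus
open Literature.MathematicalPhysics.QuantumFieldTheory.Balaban1983to89.T3NestedUnitLaws
open Literature.MathematicalPhysics.QuantumFieldTheory.Balaban1983to89.T3UnitLawDensityEML
open Literature.MathematicalPhysics.QuantumFieldTheory.Balaban1983to89.T3UnitScaleTilt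
open Literature.MathematicalPhysics.QuantumFieldTheory.Balaban1983to89.T3TiltDescent
open Literature.MathematicalPhysics.QuantumFieldTheory.Balaban1983to89.T3PrintedRegularMinimiser
open Literature.MathematicalPhysics.QuantumFieldTheory.Balaban1983to89.T3ConstrainedMinimiser (fibre)
open Literature.MathematicalPhysics.QuantumFieldTheory.Balaban1983to89.T3LevelShift
open Literature.MathematicalPhysics.QuantumFieldTheory.Balaban1983to89.Missing
open Literature.MathematicalPhysics.QuantumFieldTheory.Balaban1983to89.T4Continuum
open Summit.QuantumFields.YangMills.Theorems.FluctuationComparisonRegPrIntLWregGlue (heightDensityCan)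
open Literature.Analysis.FluidPDE (min_le_sqrt_mul)

namespace Summit.QuantumFields.YangMills.Theorems.FluctuationComparisonRegPrIntLGradientSplitKnit

/-! ## LINE g24-1 «gradient_split»: GRAD∘ → GRAD₁∘, the 4-point ≤ two one-bond differences, and the knit GRAD∘ → CRUDELOC → S2β -/

/-- GRAD∘ ⇒ GRAD₁∘ (specialisation to `K = J + 1`). [folklore] -/
theorem oneBondOscillationDepthOne_of (h : (∀ (L : ℕ), ∃ pS : ℝ, ∀ (b₀ p₀ : ℝ), 0 < b₀ → pS ≤ p₀ → 0 < p₀ → ∃ ε₁ : ℝ, 0 < ε₁ ∧ ∀ (ε₀ : ℝ), 0 < ε₀ → ε₀ ≤ ε₁ →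
    ∃ γ₁ : ℝ, 0 < γ₁ ∧ ∀ (F : T3Family) (γ : ℝ), F.L = L → 0 < γ → γ ≤ γ₁ →
      ∃ (σ : ℕ → ℝ), (∀ J, 0 ≤ σ J) ∧ (∀ a : ℕ, Tendsto (fun J : ℕ => ((J : ℝ) + 1) ^ a * σ J) atTop (𝓝 0)) ∧
        ∀ (ν : ℕ → (j : ℕ) → Measure (GaugeField (F.P j) 0 (Matrix.specialUnitaryGroup (Fin 2) ℂ))),
          (∀ K, ν K K = T4GenFunBounds.gibbsMeasure (F.P K) ((F.scheme ℰp γ).β K)) →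
          (∀ K j, j < K → ν K j = Measure.map (descend F ℰp j) (ν K (j + 1))) →
          ∀ (J K : ℕ) (hJK : J ≤ K) (ρ : GaugeField (F.P J) 0 (Matrix.specialUnitaryGroup (Fin 2) ℂ) → ℝ),
            (∀ U, PlaqSmall (θBal F.L γ b₀ p₀ J) U → 0 < ρ U) →
            ν K J = (fieldMeasure _ _ _).withDensity (fun U => ENNReal.ofReal (ρ U)) →
            ContinuousOn ρ {U | PlaqSmall (θBal F.L γ b₀ p₀ J) U} →
            ∀ (b : PBond (F.P J) 0) (U V : GaugeField (F.P J) 0 (Matrix.specialUnitaryGroup (Fin 2) ℂ)),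
              PlaqSmall (θBal F.L γ b₀ p₀ J) U → PlaqSmall (θBal F.L γ b₀ p₀ J) V →
              (∀ e, e ≠ b → U e = V e) →
              |(Real.log (ρ U) + (F.scheme ℰp γ).β K * minActionRegPr F J K hJK ε₀ U)
                  - (Real.log (ρ V) + (F.scheme ℰp γ).β K * minActionRegPr F J K hJK ε₀ V)| ≤ σ J)) : (∀ (L : ℕ), ∃ pS : ℝ, ∀ (b₀ p₀ : ℝ), 0 < b₀ → pS ≤ p₀ → 0 < p₀ → ∃ ε₁ : ℝ, 0 < ε₁ ∧ ∀ (ε₀ : ℝ), 0 < ε₀ → ε₀ ≤ ε₁ →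
    ∃ γ₁ : ℝ, 0 < γ₁ ∧ ∀ (F : T3Family) (γ : ℝ), F.L = L → 0 < γ → γ ≤ γ₁ →
      ∃ (σ : ℕ → ℝ), (∀ J, 0 ≤ σ J) ∧ (∀ a : ℕ, Tendsto (fun J : ℕ => ((J : ℝ) + 1) ^ a * σ J) atTop (𝓝 0)) ∧
        ∀ (ν : ℕ → (j : ℕ) → Measure (GaugeField (F.P j) 0 (Matrix.specialUnitaryGroup (Fin 2) ℂ))),
          (∀ K, ν K K = T4GenFunBounds.gibbsMeasure (F.P K) ((F.scheme ℰp γ).β K)) →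
          (∀ K j, j < K → ν K j = Measure.map (descend F ℰp j) (ν K (j + 1))) →
          ∀ (J : ℕ) (ρ : GaugeField (F.P J) 0 (Matrix.specialUnitaryGroup (Fin 2) ℂ) → ℝ),
            (∀ U, PlaqSmall (θBal F.L γ b₀ p₀ J) U → 0 < ρ U) →
            ν (J + 1) J = (fieldMeasure _ _ _).withDensity (fun U => ENNReal.ofReal (ρ U)) →
            ContinuousOn ρ {U | PlaqSmall (θBal F.L γ b₀ p₀ J) U} →
            ∀ (b : PBond (F.P J) 0) (U V : GaugeField (F.P J) 0 (Matrix.specialUnitaryGroup (Fin 2) ℂ)),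
              PlaqSmall (θBal F.L γ b₀ p₀ J) U → PlaqSmall (θBal F.L γ b₀ p₀ J) V →
              (∀ e, e ≠ b → U e = V e) →
              |(Real.log (ρ U) + (F.scheme ℰp γ).β (J + 1) * minActionRegPr F J (J + 1) (Nat.le_succ J) ε₀ U)
                  - (Real.log (ρ V) + (F.scheme ℰp γ).β (J + 1) * minActionRegPr F J (J + 1) (Nat.le_succ J) ε₀ V)| ≤ σ J) := by
  intro L
  obtain ⟨pS, H⟩ := h L
  refine ⟨pS, fun b₀ p₀ hb hpS hp => ?_⟩
  obtain ⟨ε₁, hε₁, H⟩ := H b₀ p₀ hb hpS hp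
  refine ⟨ε₁, hε₁, fun ε₀ hε₀ hε₀1 => ?_⟩
  obtain ⟨γ₁, hγ₁, H⟩ := H ε₀ hε₀ hε₀1
  refine ⟨γ₁, hγ₁, fun F γ hFL hγ hγle => ?_⟩
  obtain ⟨σ, hσ0, hσa, H⟩ := H F γ hFL hγ hγle
  exact ⟨σ, hσ0, hσa, fun ν hνK hνd J ρ hρpos hνρ hρcont => H ν hνK hνd J (J + 1) (Nat.le_succ J) ρ hρpos hνρ hρcont⟩

/-- **S2β ⇒ (GRAD∘'s 4-point shadow is automatic) — NOT claimed.**  Recorded instead: GRAD∘ bounds every window 4-point by `2σ_J` uniformly in the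
separation (the first-order size half of the knit). [folklore] -/
theorem abs_fourDiff_le_of_oneBond {fU fV fW fZ s : ℝ} (h1 : |fU - fV| ≤ s) (h2 : |fW - fZ| ≤ s) :
    |(fU - fV) - (fW - fZ)| ≤ 2 * s := by
  have h := abs_sub (fU - fV) (fW - fZ)
  linarith

/-- `√(e^{−t}) = e^{−t/2}`. [folklore] -/
theorem sqrt_exp_neg (t : ℝ) : Real.sqrt (Real.exp (-t)) = Real.exp (-(t / 2)) := by
  have h : Real.exp (-t) = Real.exp (-(t / 2)) ^ 2 := by
    rw [sq, ← Real.exp_add]; ring_nf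
  rw [h, Real.sqrt_sq (Real.exp_pos _).le]

/-- **COMPOSITION · GRAD∘ → CRUDELOC → S2β (PROVED).**  Thresholds merged by `max`∕`min`; `κ := κ₀/2`; `φ J := √(2·σ J·C J)`;
`J·φ J → 0` from `J²·2σ_J·C_J ≤ 2C₀(J+1)^{a+2}σ_J → 0`; pointwise `|Δ²f| ≤ min(C_J e^{−κ₀d}, 2σ_J) ≤ √(2σ_JC_J)·e^{−κ₀d/2}`.
[cite: Balaban1985UV3, (41) p.266] -/
theorem fluctuationPartSmall_of_gradient_split : ((∀ (L : ℕ), ∃ pS : ℝ, ∀ (b₀ p₀ : ℝ), 0 < b₀ → pS ≤ p₀ → 0 < p₀ → ∃ ε₁ : ℝ, 0 < ε₁ ∧ ∀ (ε₀ : ℝ), 0 < ε₀ → ε₀ ≤ ε₁ →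
    ∃ γ₁ : ℝ, 0 < γ₁ ∧ ∀ (F : T3Family) (γ : ℝ), F.L = L → 0 < γ → γ ≤ γ₁ →
      ∃ (σ : ℕ → ℝ), (∀ J, 0 ≤ σ J) ∧ (∀ a : ℕ, Tendsto (fun J : ℕ => ((J : ℝ) + 1) ^ a * σ J) atTop (𝓝 0)) ∧
        ∀ (ν : ℕ → (j : ℕ) → Measure (GaugeField (F.P j) 0 (Matrix.specialUnitaryGroup (Fin 2) ℂ))),
          (∀ K, ν K K = T4GenFunBounds.gibbsMeasure (F.P K) ((F.scheme ℰp γ).β K)) →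
          (∀ K j, j < K → ν K j = Measure.map (descend F ℰp j) (ν K (j + 1))) →
          ∀ (J K : ℕ) (hJK : J ≤ K) (ρ : GaugeField (F.P J) 0 (Matrix.specialUnitaryGroup (Fin 2) ℂ) → ℝ),
            (∀ U, PlaqSmall (θBal F.L γ b₀ p₀ J) U → 0 < ρ U) →
            ν K J = (fieldMeasure _ _ _).withDensity (fun U => ENNReal.ofReal (ρ U)) →
            ContinuousOn ρ {U | PlaqSmall (θBal F.L γ b₀ p₀ J) U} →
            ∀ (b : PBond (F.P J) 0) (U V : GaugeField (F.P J) 0 (Matrix.specialUnitaryGroup (Fin 2) ℂ)),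
              PlaqSmall (θBal F.L γ b₀ p₀ J) U → PlaqSmall (θBal F.L γ b₀ p₀ J) V →
              (∀ e, e ≠ b → U e = V e) →
              |(Real.log (ρ U) + (F.scheme ℰp γ).β K * minActionRegPr F J K hJK ε₀ U)
                  - (Real.log (ρ V) + (F.scheme ℰp γ).β K * minActionRegPr F J K hJK ε₀ V)| ≤ σ J) → (∀ (L : ℕ), ∃ pS : ℝ, ∀ (b₀ p₀ : ℝ), 0 < b₀ → pS ≤ p₀ → 0 < p₀ → ∃ ε₁ : ℝ, 0 < ε₁ ∧ ∀ (ε₀ : ℝ), 0 < ε₀ → ε₀ ≤ ε₁ →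
    ∃ γ₁ : ℝ, 0 < γ₁ ∧ ∃ κ : ℝ, 0 < κ ∧ ∀ (F : T3Family) (γ : ℝ), F.L = L → 0 < γ → γ ≤ γ₁ →
      ∃ (C : ℕ → ℝ), (∀ J, 0 ≤ C J) ∧ (∃ (a : ℕ) (C₀ : ℝ), ∀ J, C J ≤ C₀ * ((J : ℝ) + 1) ^ a) ∧
        ∀ (ν : ℕ → (j : ℕ) → Measure (GaugeField (F.P j) 0 (Matrix.specialUnitaryGroup (Fin 2) ℂ))),
          (∀ K, ν K K = T4GenFunBounds.gibbsMeasure (F.P K) ((F.scheme ℰp γ).β K)) →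
          (∀ K j, j < K → ν K j = Measure.map (descend F ℰp j) (ν K (j + 1))) →
          ∀ (J K : ℕ) (hJK : J ≤ K) (ρ : GaugeField (F.P J) 0 (Matrix.specialUnitaryGroup (Fin 2) ℂ) → ℝ),
            (∀ U, PlaqSmall (θBal F.L γ b₀ p₀ J) U → 0 < ρ U) →
            ν K J = (fieldMeasure _ _ _).withDensity (fun U => ENNReal.ofReal (ρ U)) →
            ContinuousOn ρ {U | PlaqSmall (θBal F.L γ b₀ p₀ J) U} →
            ∀ (b b' : PBond (F.P J) 0) (U V W Z : GaugeField (F.P J) 0 (Matrix.specialUnitaryGroup (Fin 2) ℂ)),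
              PlaqSmall (θBal F.L γ b₀ p₀ J) U → PlaqSmall (θBal F.L γ b₀ p₀ J) V →
              PlaqSmall (θBal F.L γ b₀ p₀ J) W → PlaqSmall (θBal F.L γ b₀ p₀ J) Z →
              (∀ e, e ≠ b → U e = V e) → (∀ e, e ≠ b' → U e = W e) → (∀ e, e ≠ b' → V e = Z e) → (∀ e, e ≠ b → W e = Z e) →
              |((Real.log (ρ U) + (F.scheme ℰp γ).β K * minActionRegPr F J K hJK ε₀ U)
                  - (Real.log (ρ V) + (F.scheme ℰp γ).β K * minActionRegPr F J K hJK ε₀ V))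
                - ((Real.log (ρ W) + (F.scheme ℰp γ).β K * minActionRegPr F J K hJK ε₀ W)
                  - (Real.log (ρ Z) + (F.scheme ℰp γ).β K * minActionRegPr F J K hJK ε₀ Z))|
                ≤ C J * Real.exp (-(κ * (b.src.tdist b'.src : ℝ)))) → (∀ (L : ℕ), ∃ pS : ℝ, ∀ (b₀ p₀ : ℝ), 0 < b₀ → pS ≤ p₀ → 0 < p₀ → ∃ ε₁ : ℝ, 0 < ε₁ ∧ ∀ (ε₀ : ℝ), 0 < ε₀ → ε₀ ≤ ε₁ →
    ∃ γ₁ : ℝ, 0 < γ₁ ∧ ∃ κ : ℝ, 0 < κ ∧ ∀ (F : T3Family) (γ : ℝ), F.L = L → 0 < γ → γ ≤ γ₁ →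
      ∃ (φ : ℕ → ℝ), (∀ J, 0 ≤ φ J) ∧ Tendsto (fun J : ℕ => (J : ℝ) * φ J) atTop (𝓝 0) ∧
        ∀ (ν : ℕ → (j : ℕ) → Measure (GaugeField (F.P j) 0 (Matrix.specialUnitaryGroup (Fin 2) ℂ))),
          (∀ K, ν K K = T4GenFunBounds.gibbsMeasure (F.P K) ((F.scheme ℰp γ).β K)) →
          (∀ K j, j < K → ν K j = Measure.map (descend F ℰp j) (ν K (j + 1))) →
          ∀ (J K : ℕ) (hJK : J ≤ K) (ρ : GaugeField (F.P J) 0 (Matrix.specialUnitaryGroup (Fin 2) ℂ) → ℝ),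
            (∀ U, PlaqSmall (θBal F.L γ b₀ p₀ J) U → 0 < ρ U) →
            ν K J = (fieldMeasure _ _ _).withDensity (fun U => ENNReal.ofReal (ρ U)) →
            ContinuousOn ρ {U | PlaqSmall (θBal F.L γ b₀ p₀ J) U} →
            ∀ (b b' : PBond (F.P J) 0) (U V W Z : GaugeField (F.P J) 0 (Matrix.specialUnitaryGroup (Fin 2) ℂ)),
              PlaqSmall (θBal F.L γ b₀ p₀ J) U → PlaqSmall (θBal F.L γ b₀ p₀ J) V →
              PlaqSmall (θBal F.L γ b₀ p₀ J) W → PlaqSmall (θBal F.L γ b₀ p₀ J) Z →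
              (∀ e, e ≠ b → U e = V e) → (∀ e, e ≠ b' → U e = W e) → (∀ e, e ≠ b' → V e = Z e) → (∀ e, e ≠ b → W e = Z e) →
              |((Real.log (ρ U) + (F.scheme ℰp γ).β K * minActionRegPr F J K hJK ε₀ U)
                  - (Real.log (ρ V) + (F.scheme ℰp γ).β K * minActionRegPr F J K hJK ε₀ V))
                - ((Real.log (ρ W) + (F.scheme ℰp γ).β K * minActionRegPr F J K hJK ε₀ W)
                  - (Real.log (ρ Z) + (F.scheme ℰp γ).β K * minActionRegPr F J K hJK ε₀ Z))|
                ≤ φ J * Real.exp (-(κ * (b.src.tdist b'.src : ℝ))))) := by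
  intro hG hC L
  obtain ⟨pS₁, H1⟩ := hG L
  obtain ⟨pS₂, H2⟩ := hC L
  refine ⟨max pS₁ pS₂, fun b₀ p₀ hb hpS hp => ?_⟩
  have hp1 : pS₁ ≤ p₀ := (le_max_left _ _).trans hpS
  have hp2 : pS₂ ≤ p₀ := (le_max_right _ _).trans hpS
  obtain ⟨ε₁, hε₁, H1⟩ := H1 b₀ p₀ hb hp1 hp
  obtain ⟨ε₂, hε₂, H2⟩ := H2 b₀ p₀ hb hp2 hp
  refine ⟨min ε₁ ε₂, lt_min hε₁ hε₂, fun ε₀ hε₀ hε₀1 => ?_⟩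
  obtain ⟨γ₁, hγ₁, H1⟩ := H1 ε₀ hε₀ (hε₀1.trans (min_le_left _ _))
  obtain ⟨γ₂, hγ₂, κ₀, hκ₀, H2⟩ := H2 ε₀ hε₀ (hε₀1.trans (min_le_right _ _))
  refine ⟨min γ₁ γ₂, lt_min hγ₁ hγ₂, κ₀ / 2, half_pos hκ₀, fun F γ hFL hγ hγle => ?_⟩
  obtain ⟨σ, hσ0, hσa, H1⟩ := H1 F γ hFL hγ (hγle.trans (min_le_left _ _))
  obtain ⟨C, hC0, hCpoly, H2⟩ := H2 F γ hFL hγ (hγle.trans (min_le_right _ _))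
  refine ⟨fun J => Real.sqrt (2 * σ J * C J), fun J => Real.sqrt_nonneg _, ?_, ?_⟩
  · -- `J·φ J → 0`: polynomial × super-polynomial
    have hCσ : Tendsto (fun J : ℕ => (J : ℝ) ^ 2 * (2 * σ J * C J)) atTop (𝓝 0) := by
      obtain ⟨a, C₀, hCle⟩ := hCpoly
      have h2 : Tendsto (fun J : ℕ => (2 * C₀) * (((J : ℝ) + 1) ^ (a + 2) * σ J)) atTop (𝓝 0) := by
        have := (hσa (a + 2)).const_mul (2 * C₀)
        rwa [mul_zero] at this
      refine squeeze_zero (fun J => ?_) (fun J => ?_) h2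
      · have := hC0 J; have := hσ0 J; positivity
      · have hJ1 : (J : ℝ) ^ 2 ≤ ((J : ℝ) + 1) ^ 2 := by nlinarith [Nat.cast_nonneg (α := ℝ) J]
        have hstep : (J : ℝ) ^ 2 * (C J * σ J) ≤ ((J : ℝ) + 1) ^ 2 * (C₀ * ((J : ℝ) + 1) ^ a * σ J) :=
          mul_le_mul hJ1 (mul_le_mul_of_nonneg_right (hCle J) (hσ0 J)) (mul_nonneg (hC0 J) (hσ0 J)) (by positivity)
        calc (J : ℝ) ^ 2 * (2 * σ J * C J) = 2 * ((J : ℝ) ^ 2 * (C J * σ J)) := by ring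
          _ ≤ 2 * (((J : ℝ) + 1) ^ 2 * (C₀ * ((J : ℝ) + 1) ^ a * σ J)) := by linarith
          _ = (2 * C₀) * (((J : ℝ) + 1) ^ (a + 2) * σ J) := by ring
    have h := hCσ.sqrt
    rw [Real.sqrt_zero] at h
    refine h.congr' (Eventually.of_forall fun J => ?_)
    show Real.sqrt ((J : ℝ) ^ 2 * (2 * σ J * C J)) = (J : ℝ) * Real.sqrt (2 * σ J * C J)
    rw [Real.sqrt_mul (sq_nonneg _), Real.sqrt_sq (Nat.cast_nonneg J)]
  · intro ν hνK hνd J K hJK ρ hρpos hνρ hρcont b b' U V W Z hU hV hW hZ hUV hUW hVZ hWZ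
    have hl := H2 ν hνK hνd J K hJK ρ hρpos hνρ hρcont b b' U V W Z hU hV hW hZ hUV hUW hVZ hWZ
    have h1 := H1 ν hνK hνd J K hJK ρ hρpos hνρ hρcont b U V hU hV hUV
    have h2 := H1 ν hνK hνd J K hJK ρ hρpos hνρ hρcont b W Z hW hZ hWZ
    set B : GaugeField (F.P J) 0 (Matrix.specialUnitaryGroup (Fin 2) ℂ) → ℝ :=
      fun U => (F.scheme ℰp γ).β K * minActionRegPr F J K hJK ε₀ U with hB
    set d : ℝ := (b.src.tdist b'.src : ℝ) with hd
    have hd0 : 0 ≤ d := by rw [hd]; exact Nat.cast_nonneg _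
    have hσJ := hσ0 J
    have hCJ := hC0 J
    -- SIZE WITHOUT LOCALITY (first order): two one-bond oscillations at the bond `b`
    have hy : |((Real.log (ρ U) + B U) - (Real.log (ρ V) + B V)) - ((Real.log (ρ W) + B W) - (Real.log (ρ Z) + B Z))| ≤ 2 * σ J :=
      abs_fourDiff_le_of_oneBond h1 h2
    -- LOCALITY WITHOUT SIZE
    have hx : |((Real.log (ρ U) + B U) - (Real.log (ρ V) + B V)) - ((Real.log (ρ W) + B W) - (Real.log (ρ Z) + B Z))|
        ≤ C J * Real.exp (-(κ₀ * d)) := hl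
    have hx0 : 0 ≤ C J * Real.exp (-(κ₀ * d)) := by positivity
    have hprod : 0 ≤ 2 * σ J * C J := by positivity
    -- KNIT: min ≤ geometric mean
    show |((Real.log (ρ U) + B U) - (Real.log (ρ V) + B V)) - ((Real.log (ρ W) + B W) - (Real.log (ρ Z) + B Z))|
        ≤ Real.sqrt (2 * σ J * C J) * Real.exp (-(κ₀ / 2 * d))
    calc |((Real.log (ρ U) + B U) - (Real.log (ρ V) + B V)) - ((Real.log (ρ W) + B W) - (Real.log (ρ Z) + B Z))|
          ≤ min (C J * Real.exp (-(κ₀ * d))) (2 * σ J) := le_min hx hy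
      _ ≤ Real.sqrt ((C J * Real.exp (-(κ₀ * d))) * (2 * σ J)) := min_le_sqrt_mul hx0 (by positivity)
      _ = Real.sqrt ((2 * σ J * C J) * Real.exp (-(κ₀ * d))) := by congr 1; ring
      _ = Real.sqrt (2 * σ J * C J) * Real.sqrt (Real.exp (-(κ₀ * d))) := Real.sqrt_mul hprod _
      _ = Real.sqrt (2 * σ J * C J) * Real.exp (-(κ₀ / 2 * d)) := by
          rw [sqrt_exp_neg, show -(κ₀ * d / 2) = -(κ₀ / 2 * d) by ring]

/-- **CRUDELOC IS NEVER HARDER THAN THE TARGET** (by text from LINE g21-1 §1, ✓there): S2β ⇒ CRUDELOC — a modulus with `J·φ J → 0` is bounded, i.e.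
polynomial of exponent `0`.  Recorded so that the knit's locality row is certified to lie BELOW S2β. [cite: Balaban1985UV3, (41) p.266] -/
theorem crudeLocality_of_fluctuationPartSmall (h : (∀ (L : ℕ), ∃ pS : ℝ, ∀ (b₀ p₀ : ℝ), 0 < b₀ → pS ≤ p₀ → 0 < p₀ → ∃ ε₁ : ℝ, 0 < ε₁ ∧ ∀ (ε₀ : ℝ), 0 < ε₀ → ε₀ ≤ ε₁ →
    ∃ γ₁ : ℝ, 0 < γ₁ ∧ ∃ κ : ℝ, 0 < κ ∧ ∀ (F : T3Family) (γ : ℝ), F.L = L → 0 < γ → γ ≤ γ₁ →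
      ∃ (φ : ℕ → ℝ), (∀ J, 0 ≤ φ J) ∧ Tendsto (fun J : ℕ => (J : ℝ) * φ J) atTop (𝓝 0) ∧
        ∀ (ν : ℕ → (j : ℕ) → Measure (GaugeField (F.P j) 0 (Matrix.specialUnitaryGroup (Fin 2) ℂ))),
          (∀ K, ν K K = T4GenFunBounds.gibbsMeasure (F.P K) ((F.scheme ℰp γ).β K)) →
          (∀ K j, j < K → ν K j = Measure.map (descend F ℰp j) (ν K (j + 1))) →
          ∀ (J K : ℕ) (hJK : J ≤ K) (ρ : GaugeField (F.P J) 0 (Matrix.specialUnitaryGroup (Fin 2) ℂ) → ℝ),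
            (∀ U, PlaqSmall (θBal F.L γ b₀ p₀ J) U → 0 < ρ U) →
            ν K J = (fieldMeasure _ _ _).withDensity (fun U => ENNReal.ofReal (ρ U)) →
            ContinuousOn ρ {U | PlaqSmall (θBal F.L γ b₀ p₀ J) U} →
            ∀ (b b' : PBond (F.P J) 0) (U V W Z : GaugeField (F.P J) 0 (Matrix.specialUnitaryGroup (Fin 2) ℂ)),
              PlaqSmall (θBal F.L γ b₀ p₀ J) U → PlaqSmall (θBal F.L γ b₀ p₀ J) V →
              PlaqSmall (θBal F.L γ b₀ p₀ J) W → PlaqSmall (θBal F.L γ b₀ p₀ J) Z →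
              (∀ e, e ≠ b → U e = V e) → (∀ e, e ≠ b' → U e = W e) → (∀ e, e ≠ b' → V e = Z e) → (∀ e, e ≠ b → W e = Z e) →
              |((Real.log (ρ U) + (F.scheme ℰp γ).β K * minActionRegPr F J K hJK ε₀ U)
                  - (Real.log (ρ V) + (F.scheme ℰp γ).β K * minActionRegPr F J K hJK ε₀ V))
                - ((Real.log (ρ W) + (F.scheme ℰp γ).β K * minActionRegPr F J K hJK ε₀ W)
                  - (Real.log (ρ Z) + (F.scheme ℰp γ).β K * minActionRegPr F J K hJK ε₀ Z))|
                ≤ φ J * Real.exp (-(κ * (b.src.tdist b'.src : ℝ))))) : (∀ (L : ℕ), ∃ pS : ℝ, ∀ (b₀ p₀ : ℝ), 0 < b₀ → pS ≤ p₀ → 0 < p₀ → ∃ ε₁ : ℝ, 0 < ε₁ ∧ ∀ (ε₀ : ℝ), 0 < ε₀ → ε₀ ≤ ε₁ →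
    ∃ γ₁ : ℝ, 0 < γ₁ ∧ ∃ κ : ℝ, 0 < κ ∧ ∀ (F : T3Family) (γ : ℝ), F.L = L → 0 < γ → γ ≤ γ₁ →
      ∃ (C : ℕ → ℝ), (∀ J, 0 ≤ C J) ∧ (∃ (a : ℕ) (C₀ : ℝ), ∀ J, C J ≤ C₀ * ((J : ℝ) + 1) ^ a) ∧
        ∀ (ν : ℕ → (j : ℕ) → Measure (GaugeField (F.P j) 0 (Matrix.specialUnitaryGroup (Fin 2) ℂ))),
          (∀ K, ν K K = T4GenFunBounds.gibbsMeasure (F.P K) ((F.scheme ℰp γ).β K)) →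
          (∀ K j, j < K → ν K j = Measure.map (descend F ℰp j) (ν K (j + 1))) →
          ∀ (J K : ℕ) (hJK : J ≤ K) (ρ : GaugeField (F.P J) 0 (Matrix.specialUnitaryGroup (Fin 2) ℂ) → ℝ),
            (∀ U, PlaqSmall (θBal F.L γ b₀ p₀ J) U → 0 < ρ U) →
            ν K J = (fieldMeasure _ _ _).withDensity (fun U => ENNReal.ofReal (ρ U)) →
            ContinuousOn ρ {U | PlaqSmall (θBal F.L γ b₀ p₀ J) U} →
            ∀ (b b' : PBond (F.P J) 0) (U V W Z : GaugeField (F.P J) 0 (Matrix.specialUnitaryGroup (Fin 2) ℂ)),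
              PlaqSmall (θBal F.L γ b₀ p₀ J) U → PlaqSmall (θBal F.L γ b₀ p₀ J) V →
              PlaqSmall (θBal F.L γ b₀ p₀ J) W → PlaqSmall (θBal F.L γ b₀ p₀ J) Z →
              (∀ e, e ≠ b → U e = V e) → (∀ e, e ≠ b' → U e = W e) → (∀ e, e ≠ b' → V e = Z e) → (∀ e, e ≠ b → W e = Z e) →
              |((Real.log (ρ U) + (F.scheme ℰp γ).β K * minActionRegPr F J K hJK ε₀ U)
                  - (Real.log (ρ V) + (F.scheme ℰp γ).β K * minActionRegPr F J K hJK ε₀ V))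
                - ((Real.log (ρ W) + (F.scheme ℰp γ).β K * minActionRegPr F J K hJK ε₀ W)
                  - (Real.log (ρ Z) + (F.scheme ℰp γ).β K * minActionRegPr F J K hJK ε₀ Z))|
                ≤ C J * Real.exp (-(κ * (b.src.tdist b'.src : ℝ)))) := by
  intro L
  obtain ⟨pS, H⟩ := h L
  refine ⟨pS, fun b₀ p₀ hb hpS hp => ?_⟩
  obtain ⟨ε₁, hε₁, H⟩ := H b₀ p₀ hb hpS hp
  refine ⟨ε₁, hε₁, fun ε₀ hε₀ hε₀1 => ?_⟩
  obtain ⟨γ₁, hγ₁, κ, hκ, H⟩ := H ε₀ hε₀ hε₀1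
  refine ⟨γ₁, hγ₁, κ, hκ, fun F γ hFL hγ hγle => ?_⟩
  obtain ⟨φ, hφ0, hφt, H⟩ := H F γ hFL hγ hγle
  have hev : ∀ᶠ J : ℕ in atTop, (J : ℝ) * φ J < 1 := (tendsto_order.1 hφt).2 1 one_pos
  obtain ⟨J₀, hJ₀⟩ := eventually_atTop.1 hev
  have hbdd : ∀ J, φ J ≤ (∑ i ∈ Finset.range (J₀ + 1), φ i) + 1 := by
    intro J
    rcases le_or_gt J J₀ with hJ | hJ
    · have : φ J ≤ ∑ i ∈ Finset.range (J₀ + 1), φ i :=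
        Finset.single_le_sum (fun i _ => hφ0 i) (Finset.mem_range.2 (Nat.lt_succ_of_le hJ))
      linarith
    · have h1 : (J : ℝ) * φ J < 1 := hJ₀ J hJ.le
      have hJ1 : (1 : ℝ) ≤ (J : ℝ) := by exact_mod_cast Nat.succ_le_of_lt (lt_of_le_of_lt (Nat.zero_le _) hJ)
      have h2 : φ J ≤ (J : ℝ) * φ J := by nlinarith [hφ0 J]
      have hsum0 : 0 ≤ ∑ i ∈ Finset.range (J₀ + 1), φ i := Finset.sum_nonneg fun i _ => hφ0 i
      linarith
  exact ⟨φ, hφ0, ⟨0, (∑ i ∈ Finset.range (J₀ + 1), φ i) + 1, fun J => by simpa using hbdd J⟩, H⟩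

end Summit.QuantumFields.YangMills.Theorems.FluctuationComparisonRegPrIntLGradientSplitKnit

end
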